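import Summits.HodgeConjecture.HodgeConjecture.Theorems.NikulinTwinTransportSquareGlueDegreeFour
import Summits.HodgeConjecture.HodgeConjecture.Theorems.NikulinTwinTransportSquareGlueDegreesTwoSix
import Summits.HodgeConjecture.HodgeConjecture.Theorems.NikulinTwinTransportAssemblyConiveauFreeEndo
import Summits.HodgeConjecture.HodgeConjecture.Theorems.NikulinTwinTransportAssemblyLambdaSplit
import Summits.HodgeConjecture.HodgeConjecture.Theorems.NikulinTwinTransportAssemblySquareAllAlgebraic
import Summits.HodgeConjecture.HodgeConjecture.Theorems.NikulinTwinTransportRealMultiplicationGlueOfMarking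
import Literature.AlgebraicGeometry.Surfaces.K3BettiNumbers
import Literature.AlgebraicGeometry.Surfaces.K3HodgeTypesProofs
import Literature.AlgebraicGeometry.HodgeTheory.HodgeModelExistence
import Literature.AlgebraicGeometry.HodgeTheory.HodgeFiltrationModelsReductionProofs

/-!
# Route NikulinTwinTransport · frame item `Assembly` (stmt-HodgeConjecture-13942) —
# the frame, the glue `SquareGlue` and the sector WITHOUT the coniveau fact

The frame item `Assembly := TwinSimilitudeAlgebraic → HodgeIsometryAlgebraic → TwinExists →
LefschetzOneOneK3 → SectorComplement → HodgeConjecture` is the combined content of the glue items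
`RealMultiplicationGlue` and `SquareGlue` (`assembly_iff_glue`, `assembly_of_glue`). Seat 13681
landed `RealMultiplicationGlue` from the marking fact alone (`realMultiplicationGlue_of_marking`);
seat 13682's Künneth bookkeeping for `SquareGlue` (files `…SquareGlue{Kunneth, Actions,
LinearAlgebra, Hodge, Endomorphisms, DegreesTwoSix, DegreeFour}`) rests, besides the marking, on
`hodgePQ_independent_of_hodgeModel` (PROVED: `…_holds`), the Künneth spanning property (PROVED:
`kunnethSpan_complexBetti`), de Rham's theorem `exists_deRhamIsoFamily`, `Huybrechts_K3_hodgeTypes_H2`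
(a consequence of the marking and de Rham, `…_of_marking_of_exists_deRhamIsoFamily`),
`b₁(K3) = b₃(K3) = 0` (`Huybrechts_K3_oddBetti_vanish`), a Hodge model of `S ⊗ S`
(`nonempty_hodgeModel`, only for the anti-vacuity conjunct of `HodgeConjectureFor`), and the
coniveau fact `Grothendieck1969_supportedClasses_le_hodgeConiveau` ("`N¹H² ⊆ H^{1,1}`", behind which
stands Deligne's mixed Hodge theory; the route now also files its K3 slice as the item
`AlgebraicClassesOneOneK3`).

This file assembles the sector, the glue and the frame WITHOUT that last input, by the
`λ`-dichotomy of `…AssemblyLambdaSplit`: for the one surface `S` carrying the real multiplication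
`e`, `eσ = λσ` and `eσ̄ = λσ̄` on the lines `H^{2,0}`, `H^{0,2}`;
* if `λ ≠ 0` the divisor classes of `S` are of type `(1,1)` for free
  (`isOfHodgeType_oneOne_of_mem_algebraicClasses_of_ne_zero`), and the bookkeeping of seat 13682 runs
  through its `hN11`-variants (`…AssemblyConiveauFreeEndo`,
  `mem_algebraicClasses_two_of_sector_of_oneOne` below — the degree-`4` theorem of `…DegreeFour`
  copied with the one-line change);
* if `λ = 0` nothing is transcendental (`forall_orthogonal_eq_zero_of_apply_lines_eq_zero`), all of
  `H²(S)` is algebraic and the Hodge conjecture for `S ⊗ S` holds outright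
  (`…AssemblySquareAllAlgebraic`).

Results: `hodgeConjectureFor_square_of_sector` (one surface), `squareGlue_of_facts'` (the glue
decl `SquareGlue`: the sector GRANTED `RealMultiplicationSqrtTwoAlgebraic` and `LefschetzOneOneK3`),
and `assembly_of_facts'` — the frame modulo exactly
`Huybrechts_K3_marking_exists`, `exists_deRhamIsoFamily`, `Huybrechts_K3_oddBetti_vanish` and
`nonempty_hodgeModel`. No new definitions, no named facts introduced.
Prover seat prover-pitem-stmt-HodgeConjecture-13942-0.
-/

noncomputable section

namespace Summit.HodgeConjecture.HodgeConjecture.Theorems.NikulinTwinTransport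

open scoped Manifold
open Module CategoryTheory MonoidalCategory CartesianMonoidalCategory
open Literature.AlgebraicGeometry.Motives Literature.AlgebraicGeometry.HodgeTheory
open Literature.AlgebraicGeometry.Surfaces Literature.Geometry.Kaehler
open Literature.AlgebraicTopology.SingularHomology
open Literature.NumberTheory.Transcendental (exists_deRhamIsoFamily)

section DegreeFour

variable {S : SchemeOver ℂ}

/-- `Corr[μ, hS ; γ, y] = pr₁*(pr₂^* y ∪ γ)` on `H²(S(ℂ); ℂ)` (the route's shape). Local notation only. -/
local notation3 (prettyPrint := false) "Corr[" μ ", " hS " ; " γ ", " y "]" =>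
  complexGysin μ (IsSmoothProjective.tensor_holds (And.left hS) (And.left hS)) (And.left hS)
    (SemiCartesianMonoidalCategory.fst _ _) (rfl : 2 * 1 + 2 * 2 + 2 * 2 = 2 * 1 + 2 * (2 + 2))
    (cupProduct (rfl : 2 * 1 + 2 * 2 = 2 * 1 + 2 * 2)
      (complexBetti.map (SemiCartesianMonoidalCategory.snd _ _) (2 * 1) y) γ)

/-- **Rational `(2,2)`-classes on `S × S` are algebraic, on the sector, with the divisor classes of
`S` of type `(1,1)` as a per-surface hypothesis `hN11`** — the statement and proof of
`mem_algebraicClasses_two_of_sector` (seat 13682) with the coniveau fact replaced by `hN11`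
(through `exists_algebraicClass_of_hodgeEndomorphism_of_oneOne`).
[cite: Varesco2023, §2 (p. 8)] [cite: HatcherAT2002, §3.2 Thm. 3.15] -/
theorem mem_algebraicClasses_two_of_sector_of_oneOne (hI : hodgePQ_independent_of_hodgeModel)
    (hdR : ∀ (E : Type) [NormedAddCommGroup E] [NormedSpace ℂ E] [FiniteDimensional ℂ E],
      Literature.NumberTheory.Transcendental.exists_deRhamIsoFamily 𝓘(ℝ, E))
    (hmark : Huybrechts_K3_marking_exists) (hHT : Huybrechts_K3_hodgeTypes_H2)
    (μ : OrientationFamily) (hS : IsK3Surface S)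
    (hN11 : ∀ d ∈ algebraicClasses S 1, IsOfHodgeType 2 S (2 * 1) 1 1 d)
    (hK4 : ∀ z : complexBetti (S ⊗ S) (2 * 2), z ∈ Submodule.span ℂ
      {v | ∃ (i j : ℕ) (h : i + j = 2 * 2) (b : complexBetti S i) (w : complexBetti S j),
        v = cupProduct h (complexBetti.map (fst S S) i b) (complexBetti.map (snd S S) j w)})
    (hKtop : ∀ z : complexBetti (S ⊗ S) (2 * (2 + 2)), z ∈ Submodule.span ℂ
      {v | ∃ (i j : ℕ) (h : i + j = 2 * (2 + 2)) (b : complexBetti S i) (w : complexBetti S j),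
        v = cupProduct h (complexBetti.map (fst S S) i b) (complexBetti.map (snd S S) j w)})
    (h1 : Subsingleton (complexBetti S 1)) (h3 : Subsingleton (complexBetti S 3))
    (hL11 : ∀ c : complexBetti S (2 * 1), IsRationalClass c → IsOfHodgeType 2 S (2 * 1) 1 1 c →
      c ∈ algebraicClasses S 1)
    (e : complexBetti S (2 * 1) →ₗ[ℂ] complexBetti S (2 * 1))
    (he_rat : ∀ y, IsRationalClass y → IsRationalClass (e y))
    (he_N : ∀ d ∈ algebraicClasses S 1, e d = 0)
    (he_T : ∀ y : complexBetti S (2 * 1),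
      (∀ d ∈ algebraicClasses S 1, cupProduct (rfl : 2 * 1 + 2 * 1 = 2 * 2) y d = 0) → e (e y) = (2 : ℂ) • y)
    (hγe : ∃ γ ∈ algebraicClasses (S ⊗ S) 2, ∀ y : complexBetti S (2 * 1), e y = Corr[μ, hS ; γ, y])
    (hU : ∀ (f : complexBetti S (2 * 1) →ₗ[ℂ] complexBetti S (2 * 1)),
      (∀ y, IsRationalClass y → IsRationalClass (f y)) →
      (∀ (i j : ℕ) y, IsOfHodgeType 2 S (2 * 1) i j y → IsOfHodgeType 2 S (2 * 1) i j (f y)) →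
      (∀ d ∈ algebraicClasses S 1, f d = 0) →
      (∀ y : complexBetti S (2 * 1), ∀ d ∈ algebraicClasses S 1,
        cupProduct (rfl : 2 * 1 + 2 * 1 = 2 * 2) (f y) d = 0) →
      ∃ a b : ℚ, ∀ y : complexBetti S (2 * 1),
        (∀ d ∈ algebraicClasses S 1, cupProduct (rfl : 2 * 1 + 2 * 1 = 2 * 2) y d = 0) →
        f y = (a : ℂ) • y + (b : ℂ) • e y)
    (c : complexBetti (S ⊗ S) (2 * 2)) (hc : IsRationalClass c)
    (hct : IsOfHodgeType (2 + 2) (S ⊗ S) (2 * 2) 2 2 c) :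
    c ∈ algebraicClasses (S ⊗ S) 2 := by
  classical
  -- Hodge models: of `S ⊗ S` from the Hodge-type hypothesis, of `S` from the K3 hypothesis
  obtain ⟨B, -⟩ := id hct
  obtain ⟨A⟩ := hS.nonempty_hodgeModel
  -- the action of `c` on `H²(S)` as a linear map
  let Fc : complexBetti S (2 * 1) →ₗ[ℂ] complexBetti S (2 * 1) :=
    (complexGysin μ (IsSmoothProjective.tensor_holds hS.1 hS.1) hS.1 (fst S S)
        (rfl : 2 * 1 + 2 * 2 + 2 * 2 = 2 * 1 + 2 * (2 + 2))) ∘ₗ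
      ((cupProduct (rfl : 2 * 1 + 2 * 2 = 2 * 1 + 2 * 2)).flip c) ∘ₗ (complexBetti.map (snd S S) (2 * 1)).hom
  have hFc : ∀ y, Fc y = Corr[μ, hS ; c, y] := fun y => rfl
  -- rational up to one scalar, and type-preserving
  obtain ⟨u, hu0, hu⟩ := exists_smul_complexGysin_isRationalClass μ
    (IsSmoothProjective.tensor_holds hS.1 hS.1) hS.1 (fst S S) (rfl : 2 * 1 + 2 * 2 + 2 * 2 = 2 * 1 + 2 * (2 + 2))
  have hF_rat : ∀ y, IsRationalClass y → IsRationalClass ((u • Fc) y) := fun y hy => by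
    rw [LinearMap.smul_apply, hFc]
    exact hu _ (IsRationalClass.cup _ (IsRationalClass.map _ hy) hc)
  have hF_typ : ∀ (i j : ℕ) y, IsOfHodgeType 2 S (2 * 1) i j y →
      IsOfHodgeType 2 S (2 * 1) i j ((u • Fc) y) := fun i j y hy => by
    rw [LinearMap.smul_apply, hFc]
    exact isOfHodgeType_smul' (isOfHodgeType_corrFst hI hdR μ hS.1 hS.1 B A
      (rfl : 2 * 1 + 2 * 2 = 2 * 1 + 2 * 2) (rfl : 2 * 1 + 2 * 2 + 2 * 2 = 2 * 1 + 2 * (2 + 2)) hct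
      (rfl : i + 2 = i + 2) (rfl : j + 2 = j + 2) hy) u
  -- `u [c]_* = [Γ]_*` with `Γ` algebraic
  obtain ⟨Γ, hΓalg, hΓ⟩ := exists_algebraicClass_of_hodgeEndomorphism_of_oneOne hmark hHT μ hS hN11 hKtop hL11 e he_rat
    he_N he_T hγe hU (u • Fc) hF_rat hF_typ
  -- a generator `p₀` of `H⁴(S)`, the fibre integral `κ`
  obtain ⟨p₀, hp₀'⟩ := exists_kroneckerPairing_fundamentalClass_ne_zero μ hS.1
  have hp₀ : p₀ ≠ 0 := by
    rintro rfl
    exact hp₀' (by rw [map_zero, LinearMap.zero_apply])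
  obtain ⟨κ, hκ0, hκ⟩ := exists_fibreIntegral_fst μ hS.1 hS.1 hKtop hp₀ (rfl : 2 * 2 + 2 * 2 = 0 + 2 * (2 + 2))
  have hκinv : κ⁻¹ * κ = 1 := inv_mul_cancel₀ hκ0
  -- `c₁ = c - u⁻¹ Γ` acts trivially on `H²`
  set c₁ : complexBetti (S ⊗ S) (2 * 2) := c - u⁻¹ • Γ with hc₁
  have hA2 : ∀ y : complexBetti S (2 * 1), Corr[μ, hS ; c₁, y] = 0 := fun y => by
    have h := hΓ y
    rw [LinearMap.smul_apply, hFc] at h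
    rw [hc₁, map_sub, map_smul, map_sub, map_smul, ← h, smul_smul, inv_mul_cancel₀ hu0, one_smul, sub_self]
  -- its actions on `H⁰`, `H⁴` are scalars `t₀`, `t₄`
  obtain ⟨t₀, ht₀⟩ := exists_eq_smul_one μ hS.1
    (complexGysin μ (IsSmoothProjective.tensor_holds hS.1 hS.1) hS.1 (fst S S)
      (rfl : 2 * 2 + 2 * 2 = 0 + 2 * (2 + 2))
      (cupProduct (Nat.zero_add (2 * 2)) (complexBetti.map (snd S S) 0
        (singularCohomology.one ℂ (ComplexPoints S))) c₁))
  obtain ⟨t₄, ht₄⟩ := exists_eq_smul_of_top μ hS.1 hp₀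
    (complexGysin μ (IsSmoothProjective.tensor_holds hS.1 hS.1) hS.1 (fst S S)
      (rfl : 2 * 2 + 2 * 2 + 2 * 2 = 2 * 2 + 2 * (2 + 2))
      (cupProduct (rfl : 2 * 2 + 2 * 2 = 2 * 2 + 2 * 2) (complexBetti.map (snd S S) (2 * 2) p₀) c₁))
  -- `c₂ = c₁ - t₀κ⁻¹ pr₂^* p₀ - t₄κ⁻¹ pr₁^* p₀` acts trivially in every degree
  set c₂ : complexBetti (S ⊗ S) (2 * 2) := c₁ - (t₀ * κ⁻¹) • complexBetti.map (snd S S) (2 * 2) p₀ -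
    (t₄ * κ⁻¹) • complexBetti.map (fst S S) (2 * 2) p₀ with hc₂
  have hone : cupProduct (Nat.zero_add (2 * 2)) (singularCohomology.one ℂ (ComplexPoints S)) p₀ = (1 : ℂ) • p₀ := by
    rw [one_cupProduct, one_smul]
  have hc₂0 : c₂ = 0 := by
    refine eq_zero_of_corr_eq_zero_four μ hS.1 hS.1 hK4 h1 h3 (fun w => ?_) (fun y => ?_) (fun w => ?_)
    · -- on `H⁰`
      obtain ⟨t, rfl⟩ := exists_eq_smul_one μ hS.1 w
      rw [map_smul, LinearMap.map_smul₂, map_smul, hc₂, map_sub, map_sub, map_smul, map_smul, map_sub,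
        map_sub, map_smul, map_smul, ht₀,
        corrFst_mapSnd_of_cup_eq μ hS.1 hS.1 (Nat.zero_add (2 * 2)) _ hκ hone,
        corrFst_mapFst_eq_zero_of_lt μ hS.1 hS.1 (Nat.zero_add (2 * 2)) _ (by norm_num), smul_zero, sub_zero,
        smul_smul, one_mul, mul_assoc, hκinv, mul_one, sub_self, smul_zero]
    · -- on `H²`
      rw [hc₂, map_sub, map_sub, map_smul, map_smul, map_sub, map_sub, map_smul, map_smul, hA2 y,
        corrFst_mapSnd_eq_zero_of_lt μ hS.1 hS.1 (rfl : 2 * 1 + 2 * 2 = 2 * 1 + 2 * 2) _ (by norm_num),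
        corrFst_mapFst_eq_zero_of_lt μ hS.1 hS.1 (rfl : 2 * 1 + 2 * 2 = 2 * 1 + 2 * 2) _ (by norm_num),
        smul_zero, smul_zero, sub_zero, sub_zero]
    · -- on `H⁴`
      obtain ⟨t, rfl⟩ := exists_eq_smul_of_top μ hS.1 hp₀ w
      rw [map_smul, LinearMap.map_smul₂, map_smul, hc₂, map_sub, map_sub, map_smul, map_smul, map_sub,
        map_sub, map_smul, map_smul, ht₄,
        corrFst_mapSnd_eq_zero_of_lt μ hS.1 hS.1 (rfl : 2 * 2 + 2 * 2 = 2 * 2 + 2 * 2) _ (by norm_num),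
        corrFst_mapFst_of_fibreIntegral μ hS.1 hS.1 (rfl : 2 * 2 + 2 * 2 = 2 * 2 + 2 * 2) _ _ hκ,
        smul_zero, sub_zero, smul_smul, mul_assoc, hκinv, mul_one, sub_self, smul_zero]
  -- hence `c = u⁻¹ Γ + t₀κ⁻¹ pr₂^* p₀ + t₄κ⁻¹ pr₁^* p₀` is algebraic
  have hp₀alg : p₀ ∈ algebraicClasses S 2 := mem_algebraicClasses_of_degree_top hS.1 (by norm_num) p₀
  have hceq : c = u⁻¹ • Γ + (t₀ * κ⁻¹) • complexBetti.map (snd S S) (2 * 2) p₀ +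
      (t₄ * κ⁻¹) • complexBetti.map (fst S S) (2 * 2) p₀ := by
    rw [hc₂, hc₁, sub_sub, sub_sub, sub_eq_zero] at hc₂0
    rw [hc₂0, add_assoc]
  rw [hceq]
  exact Submodule.add_mem _ (Submodule.add_mem _ (Submodule.smul_mem _ _ hΓalg)
    (Submodule.smul_mem _ _ (map_snd_mem_algebraicClasses hS.1 hS.1 hp₀alg)))
    (Submodule.smul_mem _ _ (map_fst_mem_algebraicClasses hS.1 hS.1 hp₀alg))

end DegreeFour

/-! ### The sector for one surface, by the `λ`-dichotomy -/

section Sector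

variable {S : SchemeOver ℂ}

/-- `Corr[μ, hS ; γ, y] = pr₁*(pr₂^* y ∪ γ)` on `H²(S(ℂ); ℂ)` (the route's shape). Local notation only. -/
local notation3 (prettyPrint := false) "Corr[" μ ", " hS " ; " γ ", " y "]" =>
  complexGysin μ (IsSmoothProjective.tensor_holds (And.left hS) (And.left hS)) (And.left hS)
    (SemiCartesianMonoidalCategory.fst _ _) (rfl : 2 * 1 + 2 * 2 + 2 * 2 = 2 * 1 + 2 * (2 + 2))
    (cupProduct (rfl : 2 * 1 + 2 * 2 = 2 * 1 + 2 * 2)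
      (complexBetti.map (SemiCartesianMonoidalCategory.snd _ _) (2 * 1) y) γ)

/-- **The Hodge conjecture for `S ⊗ S` on the sector, without the coniveau fact.** `S` a projective K3
surface with real multiplication `e` (rational, type-preserving, cup-self-adjoint, `e|_{NS} = 0`,
`e² = 2` on `NS^⊥`) whose class is algebraic (`e = [γₑ]_*`), with `End_Hdg(T) ⊆ ℚ + ℚe` (the
uniqueness clause of the sector) and Lefschetz `(1,1)` for `S`; GRANTED markings
(`Huybrechts_K3_marking_exists`), de Rham's theorem (`exists_deRhamIsoFamily`),
`b₁(S) = b₃(S) = 0` (`Huybrechts_K3_oddBetti_vanish`) and a Hodge model of `S ⊗ S`. With a marking,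
`eσ = λσ`, `eσ̄ = λσ̄` (`apply_conj_eq_smul_of_apply_eq_smul`). Case `λ = 0`: `NS^⊥ = 0`
(`forall_orthogonal_eq_zero_of_apply_lines_eq_zero`), so `N¹H²(S) = H²(S)`
(`algebraicClasses_one_eq_top_of_forall_orthogonal_eq_zero`) and every even class on `S ⊗ S` is
algebraic (`hodgeConjectureFor_square_of_algebraicClasses_one_eq_top`). Case `λ ≠ 0`: the divisor
classes are of type `(1,1)` (`isOfHodgeType_oneOne_of_mem_algebraicClasses_of_ne_zero`) and the
Künneth bookkeeping applies degree by degree: `0` (`N⁰ = H⁰`), `2` and `6`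
(`mem_algebraicClasses_one/three_of_kunneth`), `4` (`mem_algebraicClasses_two_of_sector_of_oneOne`),
`8` (top degree), `> 8` (zero), all fed with the proved Künneth spanning property
`kunnethSpan_complexBetti`. [cite: Varesco2023, §2 (p. 8)] [cite: Huybrechts2016K3, Ch. 3 §3.2 and Ch. 6 Prop. 1.2] -/
theorem hodgeConjectureFor_square_of_sector
    (hdR : ∀ (E : Type) [NormedAddCommGroup E] [NormedSpace ℂ E] [FiniteDimensional ℂ E],
      exists_deRhamIsoFamily 𝓘(ℝ, E))
    (hmark : Huybrechts_K3_marking_exists) (hodd : Huybrechts_K3_oddBetti_vanish)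
    (μ : OrientationFamily) (hS : IsK3Surface S) (hM : Nonempty (HodgeModel 4 (S ⊗ S)))
    (hL11 : ∀ c : complexBetti S (2 * 1), IsRationalClass c → IsOfHodgeType 2 S (2 * 1) 1 1 c →
      c ∈ algebraicClasses S 1)
    (e : complexBetti S (2 * 1) →ₗ[ℂ] complexBetti S (2 * 1))
    (he_rat : ∀ y, IsRationalClass y → IsRationalClass (e y))
    (he_type : ∀ (i j : ℕ) y, IsOfHodgeType 2 S (2 * 1) i j y → IsOfHodgeType 2 S (2 * 1) i j (e y))
    (he_adj : ∀ x y : complexBetti S (2 * 1),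
      cupProduct (rfl : 2 * 1 + 2 * 1 = 2 * 2) (e x) y = cupProduct (rfl : 2 * 1 + 2 * 1 = 2 * 2) x (e y))
    (he_N : ∀ d ∈ algebraicClasses S 1, e d = 0)
    (he_T : ∀ y : complexBetti S (2 * 1),
      (∀ d ∈ algebraicClasses S 1, cupProduct (rfl : 2 * 1 + 2 * 1 = 2 * 2) y d = 0) → e (e y) = (2 : ℂ) • y)
    (hγe : ∃ γ ∈ algebraicClasses (S ⊗ S) 2, ∀ y : complexBetti S (2 * 1), e y = Corr[μ, hS ; γ, y])
    (hU : ∀ (f : complexBetti S (2 * 1) →ₗ[ℂ] complexBetti S (2 * 1)),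
      (∀ y, IsRationalClass y → IsRationalClass (f y)) →
      (∀ (i j : ℕ) y, IsOfHodgeType 2 S (2 * 1) i j y → IsOfHodgeType 2 S (2 * 1) i j (f y)) →
      (∀ d ∈ algebraicClasses S 1, f d = 0) →
      (∀ y : complexBetti S (2 * 1), ∀ d ∈ algebraicClasses S 1,
        cupProduct (rfl : 2 * 1 + 2 * 1 = 2 * 2) (f y) d = 0) →
      ∃ a b : ℚ, ∀ y : complexBetti S (2 * 1),
        (∀ d ∈ algebraicClasses S 1, cupProduct (rfl : 2 * 1 + 2 * 1 = 2 * 2) y d = 0) →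
        f y = (a : ℂ) • y + (b : ℂ) • e y) :
    HodgeConjectureFor 4 (S ⊗ S) := by
  classical
  have hI : hodgePQ_independent_of_hodgeModel := hodgePQ_independent_of_hodgeModel_holds
  have hHT : Huybrechts_K3_hodgeTypes_H2 :=
    Huybrechts_K3_hodgeTypes_H2_of_marking_of_exists_deRhamIsoFamily hmark hdR
  haveI h1 : Subsingleton (complexBetti S 1) := hodd.subsingleton_one hS
  have h3 : Subsingleton (complexBetti S 3) := hodd.subsingleton_three hS
  -- a marking, the `(2,0)`-class `σ = η⁻¹x₀` and the Hodge types of `H²(S)`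
  obtain ⟨η, p₀, x₀, hp₀, ⟨hp₀int, -, hηint, hηcup, h20, -⟩, ⟨-, hxpos, -⟩⟩ := hmark S hS
  have hσ0 : η.symm x₀ ≠ 0 := by
    intro h0
    have hx : x₀ = 0 := by simpa using congrArg η h0
    subst hx
    simp [k3Form] at hxpos
  obtain ⟨hT1, hT2, hT3⟩ := hHT S hS (η.symm x₀) h20 hσ0
  rw [conjClass_marking_symm η hηint] at hT2 hT3
  -- `eσ = lσ`, `eσ̄ = lσ̄`
  obtain ⟨l, hl⟩ := (hT1 (e (η.symm x₀))).1 (he_type 2 0 _ h20)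
  have h02 : IsOfHodgeType 2 S (2 * 1) 0 2 (η.symm (star x₀)) := (hT2 _).2 ⟨1, (one_smul ℂ _).symm⟩
  obtain ⟨l', hl'⟩ := (hT2 (e (η.symm (star x₀)))).1 (he_type 0 2 _ h02)
  have hk : k3Form x₀ (star x₀) ≠ 0 := by
    rw [k3Form_comm]
    intro h0
    rw [h0, Complex.zero_re] at hxpos
    exact lt_irrefl _ hxpos
  have hll' : l = l' := apply_conj_eq_smul_of_apply_eq_smul η hp₀ hηcup x₀ hk e he_adj hl hl'
  rw [← hll'] at hl'
  by_cases hl0 : l = 0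
  · /- `λ = 0`: all of `H²(S)` is algebraic -/
    rw [hl0, zero_smul] at hl hl'
    have hT0 := forall_orthogonal_eq_zero_of_apply_lines_eq_zero η x₀ hηint hT3 hL11 e he_rat he_adj
      he_N he_T hl hl'
    exact hodgeConjectureFor_square_of_algebraicClasses_one_eq_top μ hS.1
      (algebraicClasses_one_eq_top_of_forall_orthogonal_eq_zero η hηcup hT0) hM
  · /- `λ ≠ 0`: the divisor classes are `(1,1)`; Künneth bookkeeping degree by degree -/
    have hN11 : ∀ d ∈ algebraicClasses S 1, IsOfHodgeType 2 S (2 * 1) 1 1 d := fun d hd =>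
      isOfHodgeType_oneOne_of_mem_algebraicClasses_of_ne_zero η x₀ hT3 e he_adj he_N hl hl' hl0 hd
    obtain ⟨A⟩ := hS.nonempty_hodgeModel
    have hK := kunnethSpan_complexBetti hS.1 hS.1
    have hp₀rat : IsRationalClass p₀ := hp₀int.isRationalClass
    have hSS : IsSmoothProjective 4 (S ⊗ S) := IsSmoothProjective.tensor_holds hS.1 hS.1
    refine ⟨hM, fun p c hc hct => ?_⟩
    rcases Nat.lt_or_ge p 5 with hp | hp
    · interval_cases p
      · rw [algebraicClasses_zero]; exact Submodule.mem_top
      · exact mem_algebraicClasses_one_of_kunneth hI hdR μ hS.1 A (hK 6) (hK (2 * (2 + 2))) h3 hp₀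
          hp₀rat hL11 c hc hct
      · exact mem_algebraicClasses_two_of_sector_of_oneOne hI hdR hmark hHT μ hS hN11 (hK (2 * 2))
          (hK (2 * (2 + 2))) h1 h3 hL11 e he_rat he_N he_T hγe hU c hc hct
      · exact mem_algebraicClasses_three_of_kunneth hI hdR μ hS.1 A (hK 2) (hK (2 * (2 + 2))) h1 hp₀
          hL11 c hc hct
      · exact mem_algebraicClasses_of_degree_top hSS (by norm_num) c
    · haveI := ComplexPoints.subsingleton_singularCohomology_of_lt hSS ℂ (k := 2 * p) (by omega)
      rw [Subsingleton.elim c 0]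
      exact Submodule.zero_mem _

end Sector

/-! ### The sector decl, the glue and the frame, modulo four named facts -/

section Route

/-- **The sector `SquareHodgeOfSqrtTwo` from `RealMultiplicationSqrtTwoAlgebraic` and Lefschetz
`(1,1)` — i.e. the glue `SquareGlue` — modulo markings, de Rham's theorem, `b₁(K3) = 0` and Hodge
models of products, WITHOUT the coniveau fact** (`hodgeConjectureFor_square_of_sector` surface by
surface, at any orientation family). [cite: Varesco2023, §2 (p. 8)] -/
theorem squareGlue_of_facts'
    (hdR : ∀ (E : Type) [NormedAddCommGroup E] [NormedSpace ℂ E] [FiniteDimensional ℂ E],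
      exists_deRhamIsoFamily 𝓘(ℝ, E))
    (hmark : Huybrechts_K3_marking_exists) (hodd : Huybrechts_K3_oddBetti_vanish)
    (hMod : ∀ (n : ℕ) (X : SchemeOver ℂ), nonempty_hodgeModel n X) :
    Theses.NikulinTwinTransport.SquareGlue := by
  intro hRM hL S hS e he_rat he_type he_adj he_N he_T hU
  -- an orientation family (any)
  let μ : OrientationFamily := fun _ _ hY => (ComplexPoints.isOrientableOver ℂ hY).some
  exact hodgeConjectureFor_square_of_sector hdR hmark hodd μ hS
    (hMod 4 (S ⊗ S) (IsSmoothProjective.tensor_holds hS.1 hS.1)) (hL S hS) e he_rat he_type he_adj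
    he_N he_T (hRM μ μ.hasPoincareDuality S hS e he_rat he_type he_adj he_N he_T) hU

/-- **The frame item `Assembly` modulo four named facts, without the coniveau fact**: markings of K3
surfaces (`Huybrechts_K3_marking_exists`), de Rham's theorem (`exists_deRhamIsoFamily`),
`b₁(K3) = b₃(K3) = 0` (`Huybrechts_K3_oddBetti_vanish`) and Hodge models of smooth projective
varieties (`nonempty_hodgeModel`, for the anti-vacuity conjunct on `S ⊗ S`). Of the frame's own
hypotheses X and Lefschetz `(1,1)` are used (`realMultiplicationSqrtTwoAlgebraic_of_marking`,
seat 13681, and `squareGlue_of_facts'`); Buskin's theorem and the universal twin are idle.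
[cite: Varesco2023, Thm. 2.1, Rem. 2.2 and §2 (p. 8)] -/
theorem assembly_of_facts'
    (hdR : ∀ (E : Type) [NormedAddCommGroup E] [NormedSpace ℂ E] [FiniteDimensional ℂ E],
      exists_deRhamIsoFamily 𝓘(ℝ, E))
    (hmark : Huybrechts_K3_marking_exists) (hodd : Huybrechts_K3_oddBetti_vanish)
    (hMod : ∀ (n : ℕ) (X : SchemeOver ℂ), nonempty_hodgeModel n X) :
    Theses.NikulinTwinTransport.Assembly :=
  assembly_of_squareGlue_of_marking (squareGlue_of_facts' hdR hmark hodd hMod) hmark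

end Route

end Summit.HodgeConjecture.HodgeConjecture.Theorems.NikulinTwinTransport

end
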